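import Summits.BirchSwinnertonDyer.BirchSwinnertonDyer.Theorems.EdixhovenFibreFiveSevenCiteConeClosers
import Summits.BirchSwinnertonDyer.BirchSwinnertonDyer.Theorems.AdditiveKolyvaginRoadManinFrameResidueProperROfSL2NeronValues
import Literature.NumberTheory.PAdicHodge.KatoH1BdRFilHolds
import HarnessLib

/-!
# Route `EdixhovenFibreFiveSeven` — the Manin cruxes' cite-cone closers with Kato II Prop. 1.2.3 DISCHARGED
# (TDS57 22227, KP57 23810, TDS11 22228, CORNER 23883, LOW 23884; and AKR #7 20709): binders {P1, (S5b-tower), de Rham}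

Cell `pub/bsd-wall`, seat `bsd-line-edix-p4` g7 (line `kato-lever`). TOOL theorems only (no definition, no named fact,
no `sorry`). The closers `KatoSl2NeronClosers.*_of_sl2NeronValues` (edix-p5 g4) and
`ManinFrameResidueProperROfSL2NeronValues.maninFrameResidueProperR_of_sl2NeronValues` (manin-p1 g8) display four cite-only
facts {P1 `exists_member_sl2ZetaElement_neron_values`, (S5b-tower) `exists_smul_range_expStarCoord_tower_iff_trace_log`,
hP `cupLogInjective_and_hasDualExp_of_isDeRham` (Kato LNM 1553 II Prop. 1.2.3), hDR `isDeRham_restrictedRationalTateRep`};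
their re-keys `…OfHasDualExp` (edix-p2 g8) / `…OfTS1` (edix-p4 g6) traded hP for hP′ / for Tate's (TS1). hP is now a
THEOREM — `Literature.NumberTheory.PAdicHodge.cupLogInjective_and_hasDualExp_of_isDeRham_holds` (`KatoH1BdRFilHolds`, over
`tate1967_TS1_completedAlgClosure_holds`: the elementary Kummer route + the tame structure theorem over `ℚ_p(ζ_{p^∞})`) — so
every closer is stated here on the binder set **{P1, (S5b-tower), hDR}** [+ modularity `exists_isNewformOf` for KP57 / CORNER /
LOW]: no Prop-1.2.3, no (TS1), no Scholze binder. Items stay OPEN (conditional results on P1 / (S5b-tower) / de Rham, all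
cite-only); BSD is not proved by any of this.
-/

set_option autoImplicit false
-- the Theorems namespace of a single-conjunct summit repeats the summit name by design (D-0017)
set_option linter.dupNamespace false

noncomputable section

open Literature.NumberTheory.PAdicHodge
open Literature.NumberTheory.EllipticCurves Literature.NumberTheory.EllipticCurves.ModularForms
open Literature.NumberTheory.EllipticCurves.Kato2004
open Summit.BirchSwinnertonDyer.BirchSwinnertonDyer.Theses.EdixhovenFibreFiveSeven

namespace Summit.BirchSwinnertonDyer.BirchSwinnertonDyer.Theorems.KatoSl2NeronClosersOfIsDeRham

/-- **TDS57 `TwistDegreeStepFiveSeven` (stmt-BirchSwinnertonDyer-22227) GRANTED P1, (S5b-tower) and de Rham** —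
`KatoSl2NeronClosers.twistDegreeStepFiveSeven_of_sl2NeronValues` with hP the theorem
`cupLogInjective_and_hasDualExp_of_isDeRham_holds`. CONDITIONAL; the item is not closed by this.
[cite: Kato2004Asterisque, (8.1.3) (p. 180), Thm. 9.7 (p. 189)] [cite: Kato1993LNM1553, Ch. II Prop. 1.2.3 and Thm. 1.4.1 (3)-(4)] -/
theorem twistDegreeStepFiveSeven_of_isDeRham
    (hT₂ : exists_smul_range_expStarCoord_tower_iff_trace_log) (hDR : isDeRham_restrictedRationalTateRep)
    (hP1 : exists_member_sl2ZetaElement_neron_values) : TwistDegreeStepFiveSeven :=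
  KatoSl2NeronClosers.twistDegreeStepFiveSeven_of_sl2NeronValues hT₂
    cupLogInjective_and_hasDualExp_of_isDeRham_holds hDR hP1

/-- **KP57 `KPResidueManinUnitFiveSeven` (stmt-BirchSwinnertonDyer-23810) GRANTED modularity, P1, (S5b-tower) and de Rham.**
CONDITIONAL; the item is not closed by this.
[cite: KostersPannekoek2017, Thm. 1 and Cor. 2] [cite: Kato2004Asterisque, (8.1.3) (p. 180), Thm. 9.7 (p. 189)] -/
theorem kpResidueManinUnitFiveSeven_of_isDeRham (hnf : exists_isNewformOf)
    (hT₂ : exists_smul_range_expStarCoord_tower_iff_trace_log) (hDR : isDeRham_restrictedRationalTateRep)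
    (hP1 : exists_member_sl2ZetaElement_neron_values) : KPResidueManinUnitFiveSeven :=
  KatoSl2NeronClosers.kpResidueManinUnitFiveSeven_of_sl2NeronValues hnf hT₂
    cupLogInjective_and_hasDualExp_of_isDeRham_holds hDR hP1

/-- **TDS11 `TwistDegreeStepOrdinary` (stmt-BirchSwinnertonDyer-22228) GRANTED P1, (S5b-tower) and de Rham.**
CONDITIONAL; the item is not closed by this.
[cite: Kato2004Asterisque, (8.1.3) (p. 180), Thm. 9.7 (p. 189)] [cite: EdixhovenManin1991, §4] -/
theorem twistDegreeStepOrdinary_of_isDeRham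
    (hT₂ : exists_smul_range_expStarCoord_tower_iff_trace_log) (hDR : isDeRham_restrictedRationalTateRep)
    (hP1 : exists_member_sl2ZetaElement_neron_values) : TwistDegreeStepOrdinary :=
  KatoSl2NeronClosers.twistDegreeStepOrdinary_of_sl2NeronValues hT₂
    cupLogInjective_and_hasDualExp_of_isDeRham_holds hDR hP1

/-- **CORNER `KummerCornerTorsionOptimalManinUnit` (stmt-BirchSwinnertonDyer-23883) GRANTED modularity, P1, (S5b-tower)
and de Rham.** CONDITIONAL; the item is not closed by this.
[cite: KostersPannekoek2017, Cor. 2] [cite: Kato2004Asterisque, Thm. 9.7 (p. 189)] -/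
theorem kummerCornerTorsionOptimalManinUnit_of_isDeRham (hnf : exists_isNewformOf)
    (hT₂ : exists_smul_range_expStarCoord_tower_iff_trace_log) (hDR : isDeRham_restrictedRationalTateRep)
    (hP1 : exists_member_sl2ZetaElement_neron_values) : KummerCornerTorsionOptimalManinUnit :=
  KatoSl2NeronClosers.kummerCornerTorsionOptimalManinUnit_of_sl2NeronValues hnf hT₂
    cupLogInjective_and_hasDualExp_of_isDeRham_holds hDR hP1

/-- **LOW `SupersingularTorsionOptimalManinUnitFive` (stmt-BirchSwinnertonDyer-23884) GRANTED modularity, P1, (S5b-tower)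
and de Rham.** CONDITIONAL; the item is not closed by this.
[cite: KostersPannekoek2017, Cor. 2] [cite: Kato2004Asterisque, Thm. 9.7 (p. 189)] -/
theorem supersingularTorsionOptimalManinUnitFive_of_isDeRham (hnf : exists_isNewformOf)
    (hT₂ : exists_smul_range_expStarCoord_tower_iff_trace_log) (hDR : isDeRham_restrictedRationalTateRep)
    (hP1 : exists_member_sl2ZetaElement_neron_values) : SupersingularTorsionOptimalManinUnitFive :=
  KatoSl2NeronClosers.supersingularTorsionOptimalManinUnitFive_of_sl2NeronValues hnf hT₂
    cupLogInjective_and_hasDualExp_of_isDeRham_holds hDR hP1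

/-- **AKR crux #7 `ManinFrameResidueProperR` (stmt-BirchSwinnertonDyer-20709, route `AdditiveKolyvaginRoad`) GRANTED P1,
(S5b-tower) and de Rham.** CONDITIONAL; the item is not closed by this.
[cite: Kato2004Asterisque, (8.1.3) (p. 180), Thm. 9.7 (p. 189), Thm. 13.6 (p. 227)] [cite: Kato1993LNM1553, Ch. II Prop. 1.2.3 and §1.2.7] -/
theorem maninFrameResidueProperR_of_isDeRham
    (hT₂ : exists_smul_range_expStarCoord_tower_iff_trace_log) (hDR : isDeRham_restrictedRationalTateRep)
    (hP1 : exists_member_sl2ZetaElement_neron_values) :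
    Summit.BirchSwinnertonDyer.BirchSwinnertonDyer.Theses.AdditiveKolyvaginRoad.ManinFrameResidueProperR :=
  ManinFrameResidueProperROfSL2NeronValues.maninFrameResidueProperR_of_sl2NeronValues hT₂
    cupLogInjective_and_hasDualExp_of_isDeRham_holds hDR hP1

end Summit.BirchSwinnertonDyer.BirchSwinnertonDyer.Theorems.KatoSl2NeronClosersOfIsDeRham

end
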